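import Literature.AlgebraicGeometry.Motives.MumfordTateInvariantsTensorPairing
import Literature.AlgebraicGeometry.Motives.MumfordTateInvariantsDerivation
import HarnessLib

/-!
# Block insertions `T^{b',a'}(W₂) → T^{b,a}(W)` along a retract `W₂ ⇄ W`; the contraction pairing is invariant
# under the derivation action

Pure multilinear algebra over a field `K` on the tensor spaces `T^{a,b}_K W = W^{⊗a} ⊗ (W^∨)^{⊗b}`
(`hodgeTensorSpaceOver K W a b`, Deligne, LNM 900, I §3.1), written for the cell `pub-hodgecm2` (COR-CM), seat `b27`
gen 37 (count-neutral lane MT-RANK-SIX-ISOGENY, part C: the Hodge Lie algebra of a block-diagonal direct summand).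
Theorems only; no definition, no named fact.

SETTING.  `ι : W₂ → W`, `π : W → W₂` linear (`π ι = id` where needed); a *block operator* is `X = ι Y π` for
`Y ∈ End W₂`.  For a pattern `S ⊆ Fin b`, `T ⊆ Fin a`, fixed letters `w₁ : Fin b → W` killed by `π` and
`ψ₁ : Fin a → W^∨` vanishing on `ι(W₂)`, and enumerations `eS : S ≃ Fin b'`, `eT : T ≃ Fin a'`, a **block insertion**
is a linear map `J : T^{b',a'}(W₂) → T^{b,a}(W)` with
`J((⊗u) ⊗ (⊗υ)) = (⊗_i [i ∈ S ? ι u_{eS i} : w₁ i]) ⊗ (⊗_j [j ∈ T ? υ_{eT j} ∘ π : ψ₁ j])`.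

* §1 `tensorPairing_tensorDerivation_add` — **the contraction pairing is infinitesimally invariant**:
  `⟨ρ(X) y, x⟩ + ⟨y, ρ(X) x⟩ = 0` (the differential of `⟨g y, g x⟩ = ⟨y, x⟩`, `tensorPairing_tensorSpaceActOver`).
* §2 `exists_blockInsertion` (construction by `MultilinearMap.domDomRestrict`), `blockInsertion_apply_piecewise`
  (its value on the letters `π w`, `ψ ∘ ι` is the adapted word `S.piecewise (ιπw) w₁ ⊗ T.piecewise (ψιπ) ψ₁`), and
  **`tensorDerivation_blockInsertion`** — NATURALITY: `ρ(ι Y π) ∘ J = J ∘ ρ(Y)` (the fixed letters are killed by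
  `ι Y π`, the inserted ones are moved by `Y`).
* §3 **`eq_zero_of_forall_tensorPairing_piecewise_eq_zero`** — the adapted pure tensors SPAN `T^{b,a}(W)`: a tensor of
  `T^{a,b}(W)` pairing to zero with all of them vanishes (expand every letter `w = ιπw + (w − ιπw)` multilinearly,
  `MultilinearMap.map_add_univ`, and use that the pairing is perfect).

These are the multilinear-algebra steps of the surjectivity `𝔥(H) ↠ 𝔥(H₂)` of the restriction to a block-diagonal
direct summand of a Hodge structure (`Motives/HodgeLieBlockSummandSurjective`).

## References
* [Deligne1982HodgeCycles] P. Deligne, *Hodge cycles on abelian varieties*, LNM 900 (1982), I §3.1 and proof of Prop. 3.1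
  (the spaces `T^{a,b}`, the action of `GL(V)`). [cite: Deligne1982HodgeCycles, I §3.1]
* A. Borel, *Linear Algebraic Groups*, 2nd ed. (1991), §3.8–3.9 (differentiating an action).
-/

noncomputable section

open scoped TensorProduct PiTensorProduct

namespace Literature.AlgebraicGeometry.Motives

universe u v

variable {K : Type u} [Field K] {W : Type v} [AddCommGroup W] [Module K W]
  {W₂ : Type v} [AddCommGroup W₂] [Module K W₂]

/-! ### §1 The contraction pairing is invariant under the derivation action -/

omit [Module K W₂] [AddCommGroup W₂] in
/-- A product over a tuple updated in one coordinate, read through coordinatewise functions: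
`∏ i, g i (update v k c i) = g k c · ∏_{i ≠ k} g i (v i)`. [folklore] -/
private theorem prod_apply_update_eq {ι : Type*} [Fintype ι] [DecidableEq ι] {α : Type*} (g : ι → α → K) (v : ι → α)
    (k : ι) (c : α) :
    ∏ i, g i (Function.update v k c i) = g k c * ∏ i ∈ Finset.univ \ {k}, g i (v i) := by
  have h : (fun i => g i (Function.update v k c i)) = Function.update (fun i => g i (v i)) k (g k c) := by
    funext i
    by_cases hik : i = k
    · subst hik
      simp
    · simp [Function.update_of_ne hik]
  rw [h]
  exact Finset.prod_update_of_mem (Finset.mem_univ k) _ _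

omit [Module K W₂] [AddCommGroup W₂] in
/-- The infinitesimal invariance of the contraction pairing on pure tensors. [cite: Deligne1982HodgeCycles, I §3.1] -/
theorem tensorPairing_tensorDerivation_tmul_add {a b : ℕ} (X : Module.End K W) (w : Fin b → W)
    (ψ : Fin a → Module.Dual K W) (v : Fin a → W) (φ : Fin b → Module.Dual K W) :
    tensorPairing a b (tensorDerivation b a X (PiTensorProduct.tprod K w ⊗ₜ[K] PiTensorProduct.tprod K ψ))
        (PiTensorProduct.tprod K v ⊗ₜ[K] PiTensorProduct.tprod K φ) +
      tensorPairing a b (PiTensorProduct.tprod K w ⊗ₜ[K] PiTensorProduct.tprod K ψ)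
        (tensorDerivation a b X (PiTensorProduct.tprod K v ⊗ₜ[K] PiTensorProduct.tprod K φ)) = 0 := by
  classical
  have h1 : tensorPairing a b (tensorDerivation b a X (PiTensorProduct.tprod K w ⊗ₜ[K] PiTensorProduct.tprod K ψ))
        (PiTensorProduct.tprod K v ⊗ₜ[K] PiTensorProduct.tprod K φ) =
      (∑ l, (∏ k, ψ k (v k)) * (φ l (X (w l)) * ∏ j ∈ Finset.univ \ {l}, φ j (w j))) -
        ∑ k, (ψ k (X (v k)) * ∏ i ∈ Finset.univ \ {k}, ψ i (v i)) * ∏ l, φ l (w l) := by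
    rw [tensorDerivation_tmul_tprod, map_sub, LinearMap.sub_apply, TensorProduct.sum_tmul,
      TensorProduct.tmul_sum, map_sum, map_sum, LinearMap.coe_sum, LinearMap.coe_sum, Finset.sum_apply,
      Finset.sum_apply]
    simp only [tensorPairing_tmul_tprod]
    congr 1
    · refine Finset.sum_congr rfl fun l _ => ?_
      rw [prod_apply_update_eq (fun j x => φ j x) w l (X (w l))]
    · refine Finset.sum_congr rfl fun k _ => ?_
      rw [prod_apply_update_eq (fun i (θ : Module.Dual K W) => θ (v i)) ψ k ((ψ k).comp X), LinearMap.comp_apply]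
  have h2 : tensorPairing a b (PiTensorProduct.tprod K w ⊗ₜ[K] PiTensorProduct.tprod K ψ)
        (tensorDerivation a b X (PiTensorProduct.tprod K v ⊗ₜ[K] PiTensorProduct.tprod K φ)) =
      (∑ k, (ψ k (X (v k)) * ∏ i ∈ Finset.univ \ {k}, ψ i (v i)) * ∏ l, φ l (w l)) -
        ∑ l, (∏ k, ψ k (v k)) * (φ l (X (w l)) * ∏ j ∈ Finset.univ \ {l}, φ j (w j)) := by
    rw [tensorDerivation_tmul_tprod, map_sub, TensorProduct.sum_tmul, TensorProduct.tmul_sum,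
      map_sum, map_sum]
    simp only [tensorPairing_tmul_tprod]
    congr 1
    · refine Finset.sum_congr rfl fun k _ => ?_
      rw [prod_apply_update_eq (fun i x => ψ i x) v k (X (v k))]
    · refine Finset.sum_congr rfl fun l _ => ?_
      rw [prod_apply_update_eq (fun j (θ : Module.Dual K W) => θ (w j)) φ l ((φ l).comp X), LinearMap.comp_apply]
  rw [h1, h2]
  abel

omit [Module K W₂] [AddCommGroup W₂] in
/-- **The contraction pairing is invariant under the derivation action**: `⟨ρ(X) y, x⟩ + ⟨y, ρ(X) x⟩ = 0` for
`y ∈ T^{b,a}`, `x ∈ T^{a,b}`, `X ∈ End W` — the derivative of `⟨g·y, g·x⟩ = ⟨y, x⟩`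
(`tensorPairing_tensorSpaceActOver`). [cite: Deligne1982HodgeCycles, I §3.1] -/
theorem tensorPairing_tensorDerivation_add {a b : ℕ} (X : Module.End K W) (y : hodgeTensorSpaceOver K W b a)
    (x : hodgeTensorSpaceOver K W a b) :
    tensorPairing a b (tensorDerivation b a X y) x + tensorPairing a b y (tensorDerivation a b X x) = 0 := by
  suffices h : (tensorPairing (K := K) (W := W) a b ∘ₗ tensorDerivation b a X) +
      (tensorPairing a b).compl₂ (tensorDerivation a b X) = 0 from by
    have h' := LinearMap.congr_fun (LinearMap.congr_fun h y) x
    simpa using h'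
  ext w ψ v φ
  simpa using tensorPairing_tensorDerivation_tmul_add X w ψ v φ

/-! ### §2 Block insertions: existence and naturality -/

/-- **Existence of the block insertion** `J : T^{b',a'}(W₂) → T^{b,a}(W)` for a pattern `S ⊆ Fin b`, `T ⊆ Fin a`, fixed
letters `w₁`, `ψ₁` and enumerations `eS`, `eT` (multilinear in the inserted letters: `MultilinearMap.domDomRestrict`,
`PiTensorProduct.lift`). [cite: Deligne1982HodgeCycles, I §3.1] -/
theorem exists_blockInsertion (ι : W₂ →ₗ[K] W) (π : W →ₗ[K] W₂) {a b : ℕ} (S : Finset (Fin b)) (T : Finset (Fin a))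
    (w₁ : Fin b → W) (ψ₁ : Fin a → Module.Dual K W) {a' b' : ℕ} (eS : ↥S ≃ Fin b') (eT : ↥T ≃ Fin a') :
    ∃ J : hodgeTensorSpaceOver K W₂ b' a' →ₗ[K] hodgeTensorSpaceOver K W b a,
      ∀ (u : Fin b' → W₂) (υ : Fin a' → Module.Dual K W₂),
        J (PiTensorProduct.tprod K u ⊗ₜ[K] PiTensorProduct.tprod K υ) =
          (PiTensorProduct.tprod K fun i => if h : i ∈ S then ι (u (eS ⟨i, h⟩)) else w₁ i) ⊗ₜ[K]
            PiTensorProduct.tprod K fun j => if h : j ∈ T then π.dualMap (υ (eT ⟨j, h⟩)) else ψ₁ j := by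
  classical
  let M₁ : MultilinearMap K (fun _ : Fin b' => W₂) (⨂[K]^b W) :=
    (((PiTensorProduct.tprod K : MultilinearMap K (fun _ : Fin b => W) (⨂[K]^b W)).domDomRestrict
      (fun i => i ∈ S) (fun i => w₁ i.1)).compLinearMap fun _ => ι).domDomCongr eS
  let M₂ : MultilinearMap K (fun _ : Fin a' => Module.Dual K W₂) (⨂[K]^a (Module.Dual K W)) :=
    (((PiTensorProduct.tprod K : MultilinearMap K (fun _ : Fin a => Module.Dual K W)
      (⨂[K]^a (Module.Dual K W))).domDomRestrict (fun j => j ∈ T) (fun j => ψ₁ j.1)).compLinearMap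
        fun _ => π.dualMap).domDomCongr eT
  refine ⟨TensorProduct.map (PiTensorProduct.lift M₁) (PiTensorProduct.lift M₂), fun u υ => ?_⟩
  rw [TensorProduct.map_tmul, PiTensorProduct.lift.tprod, PiTensorProduct.lift.tprod]
  rfl

section Naturality

variable {ι : W₂ →ₗ[K] W} {π : W →ₗ[K] W₂} {a b a' b' : ℕ} {S : Finset (Fin b)} {T : Finset (Fin a)}
  {w₁ : Fin b → W} {ψ₁ : Fin a → Module.Dual K W} {eS : ↥S ≃ Fin b'} {eT : ↥T ≃ Fin a'}
  {J : hodgeTensorSpaceOver K W₂ b' a' →ₗ[K] hodgeTensorSpaceOver K W b a}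

omit [Module K W₂] [AddCommGroup W₂] [Module K W] [AddCommGroup W] [Field K] in
/-- Updating an inserted word at an inserted position is inserting the updated word. [folklore] -/
private theorem update_insert_of_mem {M : Type*} {N : Type*} {c' : ℕ} {R : Finset (Fin c')} {d : ℕ} {eR : ↥R ≃ Fin d}
    (f : N → M) (g : Fin c' → M) (u : Fin d → N) {i : Fin c'} (hi : i ∈ R) (c : N) :
    Function.update (fun j => if h : j ∈ R then f (u (eR ⟨j, h⟩)) else g j) i (f c) =
      fun j => if h : j ∈ R then f (Function.update u (eR ⟨i, hi⟩) c (eR ⟨j, h⟩)) else g j := by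
  classical
  funext j
  by_cases hji : j = i
  · subst hji
    simp [hi]
  · rw [Function.update_of_ne hji]
    by_cases hj : j ∈ R
    · have hne : eR ⟨j, hj⟩ ≠ eR ⟨i, hi⟩ := fun h => hji (by simpa using eR.injective h)
      simp [hj, Function.update_of_ne hne]
    · simp [hj]

omit [Module K W₂] [AddCommGroup W₂] [Module K W] [AddCommGroup W] [Field K] in
/-- A sum over `Fin c'` of a function supported on `R` and given there through `eR : R ≃ Fin d` is a sum over `Fin d`.
[folklore] -/
private theorem sum_dite_mem_eq_sum_equiv {M : Type*} [AddCommMonoid M] {c' : ℕ} {R : Finset (Fin c')} {d : ℕ}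
    (eR : ↥R ≃ Fin d) (G : Fin d → M) :
    (∑ i : Fin c', if h : i ∈ R then G (eR ⟨i, h⟩) else 0) = ∑ k, G k := by
  classical
  rw [← Finset.sum_subset (Finset.subset_univ R) (fun i _ hi => by simp [hi]), ← Finset.sum_attach,
    ← Fintype.sum_equiv eR (fun i : ↥R => G (eR i)) G (fun _ => rfl), Finset.univ_eq_attach]
  exact Finset.sum_congr rfl fun i _ => by simp [i.2]

/-- **Naturality of block insertions**: for a block operator `X = ι Y π` (`π ι = id`), fixed letters killed by `π`
resp. vanishing on `ι(W₂)`, `ρ_{b,a}(ι Y π) (J z) = J (ρ_{b',a'}(Y) z)` — the fixed letters contribute `0`, the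
inserted ones are moved by `Y`. [cite: Deligne1982HodgeCycles, I §3.1] -/
theorem tensorDerivation_blockInsertion (hπι : π ∘ₗ ι = LinearMap.id) (hw₁ : ∀ i, π (w₁ i) = 0)
    (hψ₁ : ∀ j, ψ₁ j ∘ₗ ι = 0)
    (hJ : ∀ (u : Fin b' → W₂) (υ : Fin a' → Module.Dual K W₂),
      J (PiTensorProduct.tprod K u ⊗ₜ[K] PiTensorProduct.tprod K υ) =
        (PiTensorProduct.tprod K fun i => if h : i ∈ S then ι (u (eS ⟨i, h⟩)) else w₁ i) ⊗ₜ[K]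
          PiTensorProduct.tprod K fun j => if h : j ∈ T then π.dualMap (υ (eT ⟨j, h⟩)) else ψ₁ j)
    (Y : Module.End K W₂) (z : hodgeTensorSpaceOver K W₂ b' a') :
    tensorDerivation b a (ι ∘ₗ Y ∘ₗ π) (J z) = J (tensorDerivation b' a' Y z) := by
  classical
  have hπι' : ∀ x, π (ι x) = x := fun x => LinearMap.congr_fun hπι x
  suffices h : tensorDerivation b a (ι ∘ₗ Y ∘ₗ π) ∘ₗ J = J ∘ₗ tensorDerivation b' a' Y from LinearMap.congr_fun h z
  ext u υ
  simp only [LinearMap.compMultilinearMap_apply, TensorProduct.AlgebraTensorModule.curry_apply, TensorProduct.curry_apply,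
    LinearMap.coe_restrictScalars, LinearMap.comp_apply]
  rw [hJ, tensorDerivation_tmul_tprod, tensorDerivation_tmul_tprod]
  simp only [map_sub, TensorProduct.sum_tmul, TensorProduct.tmul_sum, map_sum, hJ]
  congr 1
  · -- vector slots
    have hterm : ∀ i : Fin b,
        (PiTensorProduct.tprod K (Function.update (fun j => if h : j ∈ S then ι (u (eS ⟨j, h⟩)) else w₁ j) i
          ((ι ∘ₗ Y ∘ₗ π) (if h : i ∈ S then ι (u (eS ⟨i, h⟩)) else w₁ i)))) ⊗ₜ[K]
          (PiTensorProduct.tprod K fun j => if h : j ∈ T then π.dualMap (υ (eT ⟨j, h⟩)) else ψ₁ j) =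
        if h : i ∈ S then
          (PiTensorProduct.tprod K fun j => if h' : j ∈ S then
              ι (Function.update u (eS ⟨i, h⟩) (Y (u (eS ⟨i, h⟩))) (eS ⟨j, h'⟩)) else w₁ j) ⊗ₜ[K]
            (PiTensorProduct.tprod K fun j => if h : j ∈ T then π.dualMap (υ (eT ⟨j, h⟩)) else ψ₁ j)
        else 0 := by
      intro i
      by_cases hi : i ∈ S
      · simp only [dif_pos hi]
        have hval : (ι ∘ₗ Y ∘ₗ π) (ι (u (eS ⟨i, hi⟩))) = ι (Y (u (eS ⟨i, hi⟩))) := by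
          simp only [LinearMap.comp_apply, hπι']
        rw [hval, update_insert_of_mem (fun x => ι x) w₁ u hi]
      · simp only [dif_neg hi]
        have hval : (ι ∘ₗ Y ∘ₗ π) (w₁ i) = 0 := by simp only [LinearMap.comp_apply, hw₁ i, map_zero]
        rw [hval, MultilinearMap.map_update_zero, TensorProduct.zero_tmul]
    simp_rw [hterm]
    exact sum_dite_mem_eq_sum_equiv eS fun k =>
      (PiTensorProduct.tprod K fun j => if h' : j ∈ S then ι (Function.update u k (Y (u k)) (eS ⟨j, h'⟩)) else w₁ j) ⊗ₜ[K]
        (PiTensorProduct.tprod K fun j => if h : j ∈ T then π.dualMap (υ (eT ⟨j, h⟩)) else ψ₁ j)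
  · -- covector slots
    have hterm : ∀ j : Fin a,
        (PiTensorProduct.tprod K fun i => if h : i ∈ S then ι (u (eS ⟨i, h⟩)) else w₁ i) ⊗ₜ[K]
          PiTensorProduct.tprod K (Function.update (fun j => if h : j ∈ T then π.dualMap (υ (eT ⟨j, h⟩)) else ψ₁ j) j
            ((if h : j ∈ T then π.dualMap (υ (eT ⟨j, h⟩)) else ψ₁ j).comp (ι ∘ₗ Y ∘ₗ π))) =
        if h : j ∈ T then
          (PiTensorProduct.tprod K fun i => if h : i ∈ S then ι (u (eS ⟨i, h⟩)) else w₁ i) ⊗ₜ[K]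
            (PiTensorProduct.tprod K fun l => if h' : l ∈ T then
              π.dualMap (Function.update υ (eT ⟨j, h⟩) ((υ (eT ⟨j, h⟩)).comp Y) (eT ⟨l, h'⟩)) else ψ₁ l)
        else 0 := by
      intro j
      by_cases hj : j ∈ T
      · simp only [dif_pos hj]
        have hval : (π.dualMap (υ (eT ⟨j, hj⟩))).comp (ι ∘ₗ Y ∘ₗ π) = π.dualMap ((υ (eT ⟨j, hj⟩)).comp Y) := by
          refine LinearMap.ext fun x => ?_
          simp only [LinearMap.comp_apply, LinearMap.dualMap_apply, hπι']
        rw [hval, update_insert_of_mem (fun θ => π.dualMap θ) ψ₁ υ hj]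
      · simp only [dif_neg hj]
        have hval : (ψ₁ j).comp (ι ∘ₗ Y ∘ₗ π) = 0 := by
          rw [← LinearMap.comp_assoc, ← LinearMap.comp_assoc, hψ₁ j, LinearMap.zero_comp, LinearMap.zero_comp]
        rw [hval, MultilinearMap.map_update_zero, TensorProduct.tmul_zero]
    simp_rw [hterm]
    exact sum_dite_mem_eq_sum_equiv eT fun k =>
      (PiTensorProduct.tprod K fun i => if h : i ∈ S then ι (u (eS ⟨i, h⟩)) else w₁ i) ⊗ₜ[K]
        (PiTensorProduct.tprod K fun l => if h' : l ∈ T then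
          π.dualMap (Function.update υ k ((υ k).comp Y) (eT ⟨l, h'⟩)) else ψ₁ l)

/-- **The block insertion on the letters `π w`, `ψ ∘ ι` is the adapted word**:
`J((⊗_k π w_{eS⁻¹ k}) ⊗ (⊗_k ψ_{eT⁻¹ k} ∘ ι)) = (⊗ S.piecewise (ιπw) w₁) ⊗ (⊗ T.piecewise (ψιπ) ψ₁)`.
[cite: Deligne1982HodgeCycles, I §3.1] -/
theorem blockInsertion_apply_piecewise {w : Fin b → W} {ψ : Fin a → Module.Dual K W}
    (hJ : ∀ (u : Fin b' → W₂) (υ : Fin a' → Module.Dual K W₂),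
      J (PiTensorProduct.tprod K u ⊗ₜ[K] PiTensorProduct.tprod K υ) =
        (PiTensorProduct.tprod K fun i => if h : i ∈ S then ι (u (eS ⟨i, h⟩)) else w₁ i) ⊗ₜ[K]
          PiTensorProduct.tprod K fun j => if h : j ∈ T then π.dualMap (υ (eT ⟨j, h⟩)) else ψ₁ j) :
    J ((PiTensorProduct.tprod K fun k => π (w ((eS.symm k : ↥S) : Fin b))) ⊗ₜ[K]
        PiTensorProduct.tprod K fun k => ι.dualMap (ψ ((eT.symm k : ↥T) : Fin a))) =
      PiTensorProduct.tprod K (S.piecewise (fun i => ι (π (w i))) w₁) ⊗ₜ[K]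
        PiTensorProduct.tprod K (T.piecewise (fun j => π.dualMap (ι.dualMap (ψ j))) ψ₁) := by
  classical
  rw [hJ]
  congr 1
  · congr 1
    funext i
    by_cases hi : i ∈ S
    · rw [dif_pos hi, Finset.piecewise_eq_of_mem _ _ _ hi, Equiv.symm_apply_apply]
    · rw [dif_neg hi, Finset.piecewise_eq_of_notMem _ _ _ hi]
  · congr 1
    funext j
    by_cases hj : j ∈ T
    · rw [dif_pos hj, Finset.piecewise_eq_of_mem _ _ _ hj, Equiv.symm_apply_apply]
    · rw [dif_neg hj, Finset.piecewise_eq_of_notMem _ _ _ hj]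

end Naturality

/-! ### §3 The adapted pure tensors span -/

/-- **A tensor pairing to zero with all adapted pure tensors is zero.**  For `ι : W₂ → W`, `π : W → W₂` and
`s ∈ T^{a,b}(W)`: if `⟨(⊗ S.piecewise (ιπw) (w − ιπw)) ⊗ (⊗ T.piecewise (ψιπ) (ψ − ψιπ)), s⟩ = 0` for all patterns
`S`, `T` and all letters `w`, `ψ`, then `s = 0` — every letter splits as `w = ιπw + (w − ιπw)`, a pure tensor expands
into the `2^{a+b}` adapted words (`MultilinearMap.map_add_univ`), pure tensors span, and the contraction pairing is
perfect (`eq_of_forall_tensorPairing_eq`). [cite: Deligne1982HodgeCycles, I §3.1] -/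
theorem eq_zero_of_forall_tensorPairing_piecewise_eq_zero [FiniteDimensional K W] (ι : W₂ →ₗ[K] W)
    (π : W →ₗ[K] W₂) {a b : ℕ} (s : hodgeTensorSpaceOver K W a b)
    (h : ∀ (S : Finset (Fin b)) (T : Finset (Fin a)) (w : Fin b → W) (ψ : Fin a → Module.Dual K W),
      tensorPairing a b (PiTensorProduct.tprod K (S.piecewise (fun i => ι (π (w i))) (fun i => w i - ι (π (w i)))) ⊗ₜ[K]
        PiTensorProduct.tprod K (T.piecewise (fun j => π.dualMap (ι.dualMap (ψ j)))
          (fun j => ψ j - π.dualMap (ι.dualMap (ψ j))))) s = 0) :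
    s = 0 := by
  classical
  have hL : (LinearMap.applyₗ s) ∘ₗ tensorPairing (K := K) (W := W) a b = 0 := by
    ext w ψ
    simp only [LinearMap.compMultilinearMap_apply, TensorProduct.AlgebraTensorModule.curry_apply,
      TensorProduct.curry_apply, LinearMap.coe_restrictScalars, LinearMap.comp_apply, LinearMap.applyₗ_apply_apply,
      LinearMap.zero_apply]
    have hw : w = (fun i => ι (π (w i))) + fun i => w i - ι (π (w i)) := by
      funext i
      simp
    have hψ : ψ = (fun j => π.dualMap (ι.dualMap (ψ j))) + fun j => ψ j - π.dualMap (ι.dualMap (ψ j)) := by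
      funext j
      simp
    rw [hw, MultilinearMap.map_add_univ, hψ, MultilinearMap.map_add_univ, TensorProduct.sum_tmul, map_sum,
      LinearMap.coe_sum, Finset.sum_apply]
    refine Finset.sum_eq_zero fun S _ => ?_
    rw [TensorProduct.tmul_sum, map_sum, LinearMap.coe_sum, Finset.sum_apply]
    refine Finset.sum_eq_zero fun T _ => ?_
    exact h S T w ψ
  refine eq_of_forall_tensorPairing_eq fun y => ?_
  have := LinearMap.congr_fun hL y
  simp only [LinearMap.comp_apply, LinearMap.applyₗ_apply_apply, LinearMap.zero_apply] at this
  rw [this, map_zero]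

end Literature.AlgebraicGeometry.Motives

end
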